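import Mathlib.Analysis.Calculus.ContDiff.WithLp
import Mathlib.Geometry.Manifold.Instances.Sphere
import HarnessLib

/-!
# The surgery map `S¹ × Sⁿ → Sⁿ⁺¹` (Budney–Gabai Thm. 3.13, sentence 4: the Cerf–Palais step)

Fact seat of `Literature.Topology.FourManifolds.BudneyGabai2019_thm_3_13` (`NonSeparatingSpheres.lean`;
R. Budney, D. Gabai, *Knotted 3-balls in `S⁴`*, arXiv:1912.09029 (v2), Thm. 3.13: `Diff(S¹ × Sⁿ)`
acts transitively on the non-separating `n`-spheres of `S¹ × Sⁿ`).  Sentences 1–3 of the printed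
proof are formalized in the sibling files up to `NonSeparatingSpheresDrill.lean`, which reduces the
case `n ≥ 3` to the uniqueness of reducing balls (Budney–Gabai Thm. 3.12) in the form of the
hypothesis `Hred` of `exists_image_eq_range_standardSphere_of_reducingBall`: *a non-separating
sphere which is flat over a tube `S¹ × B̄(p₀, r)` is standard*.  For Thm. 3.12 the source offers
(p. 22, after Thm. 3.12): *"Alternatively attach a `Sⁿ⁻¹ × D²` to obtain `Sⁿ⁺¹` where the reducing
ball is now an `n`-ball `Δ₁` with boundary a standard `(n-1)`-sphere. By the Cerf–Palais theorem
there is a diffeomorphism of this sphere taking `Δ₁` to a standard `n`-ball fixing `∂Δ₁`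
pointwise."*  This file supplies the explicit model of that attachment:

* `Surgery.map n : S¹ × Sⁿ → Sⁿ⁺¹`, `Θ (u, p) = (p₀ re u, p₀ im u, p₁, …, pₙ)` — a **global**
  smooth map (`contMDiff_map`) which is a diffeomorphism from the open solid torus `{p₀ > 0}`
  onto the complement of the great sphere `S_L = {v₀ = v₁ = 0}` (`injOn_map`,
  `image_map_setOf_pos`, `mfderiv_map_injective`), with explicit inverse `Surgery.inv n`,
  `v ↦ (z/‖z‖, (‖z‖, v₂, …, vₙ₊₁))`, `z = v₀ + i v₁` (`inv_map`, `map_inv`, `contMDiffOn_inv`):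
  collapsing every circle `S¹ × {p}` over the equator `{p₀ = 0}` to a point realises
  `Sⁿ⁺¹ = (S¹ × Dⁿ) ∪ (D² × Sⁿ⁻¹)`;
* `Surgery.equator n : Sⁿ → Sⁿ⁺¹`, `p ↦ (p₀, 0, p₁, …, pₙ) = Θ (1, p)` — the standard sphere
  `{1} × Sⁿ` goes to the equatorial great sphere `{v₁ = 0}` (`range_equator`), an injective
  immersion (`injective_equator`, `mfderiv_equator_injective`); the fibre `{1} × {p₀ > 0}` goes to
  the open half great-sphere `H₊ = {v₁ = 0, v₀ > 0}`, the standard `n`-ball of the quotation being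
  its closure `H₊ ∪ S_L`;
* `map_eq_equator` — the only failure of injectivity relevant later: `Θ (-1, p) = Θ (1, p*)`
  with `p*₀ = -p₀`.

Everything here is elementary and proved; the definitions are explicit formulas.

## References

* R. Budney, D. Gabai, *Knotted 3-balls in `S⁴`*, arXiv:1912.09029 (v2), §3, Thm. 3.12, the
  remark following it, and Thm. 3.13 (p. 22). [BudneyGabai2019]
* R. Palais, *Extending diffeomorphisms*, Proc. AMS 11 (1960), Thm. B; J. Cerf, *Topologie de
  certains espaces de plongements*, Bull. SMF 89 (1961). [Palais1960]
-/

noncomputable section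

open scoped Manifold ContDiff Topology Real
open Set Function Metric Module Complex

/-- Local notation: Euclidean model space. -/
local notation "𝔼 " n:arg => EuclideanSpace ℝ (Fin n)
/-- Local notation: the unit sphere `Sⁿ ⊆ ℝⁿ⁺¹`. -/
local notation "𝕊 " n:arg => (Metric.sphere (0 : EuclideanSpace ℝ (Fin (n + 1))) 1)

namespace Literature.Topology.FourManifolds

namespace BudneyGabai2019_thm_3_13

namespace Surgery

variable (n : ℕ)

/-- The coordinate map `ℂ × ℝⁿ⁺¹ → ℝⁿ⁺²`, `(w, x) ↦ (x₀ re w, x₀ im w, x₁, …, xₙ)`. [folklore] -/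
def vec (q : ℂ × 𝔼 (n + 1)) : 𝔼 (n + 1 + 1) :=
  WithLp.toLp 2 (Fin.cons (q.2 0 * q.1.re) (Fin.cons (q.2 0 * q.1.im) fun j : Fin n ↦ q.2 j.succ))

/-- Coordinate/unfolding lemma `vec_apply_zero`. [folklore] -/
@[simp] theorem vec_apply_zero (q : ℂ × 𝔼 (n + 1)) : vec n q 0 = q.2 0 * q.1.re := by
  simp [vec]

/-- Coordinate/unfolding lemma `vec_apply_succ_zero`. [folklore] -/
@[simp] theorem vec_apply_succ_zero (q : ℂ × 𝔼 (n + 1)) :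
    vec n q (0 : Fin (n + 1)).succ = q.2 0 * q.1.im := by
  simp only [vec, PiLp.toLp_apply]
  exact Fin.cons_succ _ _ 0

/-- Coordinate/unfolding lemma `vec_apply_one`. [folklore] -/
@[simp] theorem vec_apply_one (q : ℂ × 𝔼 (n + 1)) : vec n q 1 = q.2 0 * q.1.im :=
  vec_apply_succ_zero n q

/-- Coordinate/unfolding lemma `vec_apply_succ_succ`. [folklore] -/
@[simp] theorem vec_apply_succ_succ (q : ℂ × 𝔼 (n + 1)) (j : Fin n) :
    vec n q j.succ.succ = q.2 j.succ := by
  simp only [vec, PiLp.toLp_apply, Fin.cons_succ]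

/-- `vec` is smooth (polynomial). [folklore] -/
theorem contDiff_vec : ContDiff ℝ ∞ (vec n) := by
  rw [contDiff_euclidean]
  intro i
  refine Fin.cases ?_ (fun i' ↦ Fin.cases ?_ (fun j ↦ ?_) i') i
  · simp only [vec_apply_zero]
    exact ((contDiff_piLp_apply (𝕜 := ℝ) (p := 2) (i := (0 : Fin (n + 1)))).comp contDiff_snd).mul
      (Complex.reCLM.contDiff.comp contDiff_fst)
  · simp only [vec_apply_succ_zero]
    exact ((contDiff_piLp_apply (𝕜 := ℝ) (p := 2) (i := (0 : Fin (n + 1)))).comp contDiff_snd).mul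
      (Complex.imCLM.contDiff.comp contDiff_fst)
  · simp only [vec_apply_succ_succ]
    exact (contDiff_piLp_apply (𝕜 := ℝ) (p := 2) (i := j.succ)).comp contDiff_snd

/-- `‖vec (w, x)‖² = x₀² ‖w‖² + Σⱼ x_{j+1}²`; for `‖w‖ = 1` this is `‖x‖²`. [folklore] -/
theorem norm_vec_sq (w : ℂ) (hw : ‖w‖ = 1) (x : 𝔼 (n + 1)) : ‖vec n (w, x)‖ ^ 2 = ‖x‖ ^ 2 := by
  have hw2 : w.re ^ 2 + w.im ^ 2 = 1 := by
    have h := Complex.normSq_eq_norm_sq w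
    rw [hw, Complex.normSq_apply] at h
    nlinarith [h]
  rw [EuclideanSpace.real_norm_sq_eq, EuclideanSpace.real_norm_sq_eq, Fin.sum_univ_succ,
    Fin.sum_univ_succ, Fin.sum_univ_succ (f := fun i ↦ x i ^ 2)]
  simp only [vec_apply_zero, vec_apply_succ_zero, vec_apply_succ_succ]
  nlinarith [hw2]


/-! ### `Fact` instances for Mathlib's sphere API -/

/-- `finrank ℝ ℝᵐ⁺¹ = m + 1` as a `Fact`. [folklore] -/
theorem fact_finrank_euclideanSpace_succ (m : ℕ) : Fact (finrank ℝ (𝔼 (m + 1)) = m + 1) :=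
  ⟨finrank_euclideanSpace_fin⟩

attribute [local instance] fact_finrank_euclideanSpace_succ
attribute [local instance] finrank_real_complex_fact'

/-- **A map into a sphere is smooth on an open set if it is smooth there as a vector-valued map**
(local form of Mathlib's `ContMDiff.codRestrict_sphere`, by restriction to the open
submanifold). [folklore] -/
theorem contMDiffOn_codRestrict_sphere {F H : Type*} [NormedAddCommGroup F] [NormedSpace ℝ F]
    [TopologicalSpace H] {I : ModelWithCorners ℝ F H} {N : Type*} [TopologicalSpace N]
    [ChartedSpace H N] [IsManifold I ∞ N] {E : Type*} [NormedAddCommGroup E]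
    [InnerProductSpace ℝ E] {k : ℕ} [Fact (finrank ℝ E = k + 1)] {f : N → E} {O : Set N}
    (hO : IsOpen O) (hf : ContMDiffOn I 𝓘(ℝ, E) ∞ f O) (hf' : ∀ x, f x ∈ sphere (0 : E) 1) :
    ContMDiffOn I (𝓡 k) ∞ (Set.codRestrict f _ hf') O := by
  intro x hx
  set U : TopologicalSpace.Opens N := ⟨O, hO⟩
  have hg : ContMDiff I 𝓘(ℝ, E) ∞ (f ∘ (Subtype.val : U → N)) :=
    hf.comp_contMDiff contMDiff_subtype_val fun y ↦ y.2
  have hg' : ContMDiff I (𝓡 k) ∞ (Set.codRestrict (f ∘ (Subtype.val : U → N)) _ fun y ↦ hf' y.1) :=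
    hg.codRestrict_sphere _
  have h2 : ContMDiffAt I (𝓡 k) ∞ (fun y : U ↦ Set.codRestrict f _ hf' y.1) ⟨x, hx⟩ := hg' ⟨x, hx⟩
  exact (contMDiffAt_subtype_iff.1 h2).contMDiffWithinAt

/-! ### The surgery map `Θ : S¹ × Sⁿ → Sⁿ⁺¹` -/

/-- **The surgery map** `Θ : S¹ × Sⁿ → Sⁿ⁺¹`, `Θ(u, p) = (p₀ re u, p₀ im u, p₁, …, pₙ)`: it
collapses each circle `S¹ × {p}` over the equator `{p₀ = 0}` of `Sⁿ` to a point, and maps the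
open solid torus `S¹ × {p₀ > 0}` diffeomorphically onto the complement of the great `(n-1)`-sphere
`{v₀ = v₁ = 0}` of `Sⁿ⁺¹` (the decomposition `Sⁿ⁺¹ = S¹ × Dⁿ ∪ D² × Sⁿ⁻¹`, i.e. the result of
surgery on the circle `S¹ × {north pole}` in `S¹ × Sⁿ` is `Sⁿ⁺¹`; Budney–Gabai 2019, remark after
Thm. 3.12: "attach a `Sⁿ⁻¹ × D²` to obtain `Sⁿ⁺¹`"). [folklore] -/
def map (q : Circle × 𝕊 n) : 𝕊 (n + 1) :=
  ⟨vec n ((q.1 : ℂ), (q.2 : 𝔼 (n + 1))), by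
    have h := norm_vec_sq n (q.1 : ℂ) q.1.norm_coe (q.2 : 𝔼 (n + 1))
    rw [norm_eq_of_mem_sphere q.2, one_pow] at h
    rw [mem_sphere_zero_iff_norm]
    exact (pow_left_inj₀ (norm_nonneg _) zero_le_one two_ne_zero).1 (by rw [h, one_pow])⟩

/-- The underlying vector of `map n q`. [folklore] -/
@[simp] theorem coe_map (q : Circle × 𝕊 n) :
    (map n q : 𝔼 (n + 1 + 1)) = vec n ((q.1 : ℂ), (q.2 : 𝔼 (n + 1))) := rfl

/-- **The surgery map is smooth** (for the product model of `S¹ × Sⁿ`). [folklore] -/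
theorem contMDiff_map : ContMDiff ((𝓡 1).prod (𝓡 n)) (𝓡 (n + 1)) ∞ (map n) := by
  have hc : ContMDiff (𝓡 1) 𝓘(ℝ, ℂ) ∞ (fun u : Circle ↦ (u : ℂ)) := contMDiff_coe_sphere
  have h1 : ContMDiff ((𝓡 1).prod (𝓡 n)) 𝓘(ℝ, ℂ × 𝔼 (n + 1)) ∞
      (fun q : Circle × 𝕊 n ↦ (((q.1 : ℂ), (q.2 : 𝔼 (n + 1))) : ℂ × 𝔼 (n + 1))) :=
    (hc.comp contMDiff_fst).prodMk_space (contMDiff_coe_sphere.comp contMDiff_snd)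
  exact ((contDiff_vec n).contMDiff.comp h1).codRestrict_sphere _

/-- The surgery map is continuous. [folklore] -/
theorem continuous_map : Continuous (map n) := (contMDiff_map n).continuous

/-- The `z`-part of the surgery map has squared norm `p₀²`:
`(Θ q)₀² + (Θ q)₁² = p₀²`. [folklore] -/
theorem map_apply_zero_sq_add (q : Circle × 𝕊 n) :
    (map n q : 𝔼 (n + 1 + 1)) 0 ^ 2 + (map n q : 𝔼 (n + 1 + 1)) 1 ^ 2 =
      (q.2 : 𝔼 (n + 1)) 0 ^ 2 := by
  have hw2 : (q.1 : ℂ).re ^ 2 + (q.1 : ℂ).im ^ 2 = 1 := by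
    have h := Complex.normSq_eq_norm_sq (q.1 : ℂ)
    rw [q.1.norm_coe, Complex.normSq_apply] at h
    nlinarith [h]
  simp only [coe_map, vec_apply_zero, vec_apply_one]
  nlinarith [hw2]

/-! ### The equatorial inclusion `Sⁿ ↪ Sⁿ⁺¹` -/

/-- **The equatorial inclusion** `ι_E : Sⁿ → Sⁿ⁺¹`, `p ↦ (p₀, 0, p₁, …, pₙ)`: the restriction of
the surgery map to the standard sphere `{1} × Sⁿ`; its image is the great sphere `{v₁ = 0}`.
[folklore] -/
def equator (p : 𝕊 n) : 𝕊 (n + 1) := map n (1, p)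

/-- `Θ (1, p) = ι_E p` (definitional). [folklore] -/
theorem map_one (p : 𝕊 n) : map n (1, p) = equator n p := rfl

/-- Coordinate/unfolding lemma `coe_equator_apply_zero`. [folklore] -/
@[simp] theorem coe_equator_apply_zero (p : 𝕊 n) :
    (equator n p : 𝔼 (n + 1 + 1)) 0 = (p : 𝔼 (n + 1)) 0 := by
  simp [equator]

/-- Coordinate/unfolding lemma `coe_equator_apply_one`. [folklore] -/
@[simp] theorem coe_equator_apply_one (p : 𝕊 n) : (equator n p : 𝔼 (n + 1 + 1)) 1 = 0 := by
  simp [equator]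

/-- Coordinate/unfolding lemma `coe_equator_apply_succ_succ`. [folklore] -/
@[simp] theorem coe_equator_apply_succ_succ (p : 𝕊 n) (j : Fin n) :
    (equator n p : 𝔼 (n + 1 + 1)) j.succ.succ = (p : 𝔼 (n + 1)) j.succ := by
  simp [equator]

/-- The equatorial inclusion is smooth. [folklore] -/
theorem contMDiff_equator : ContMDiff (𝓡 n) (𝓡 (n + 1)) ∞ (equator n) :=
  (contMDiff_map n).comp (contMDiff_const.prodMk contMDiff_id)

/-- The equatorial inclusion is injective. [folklore] -/
theorem injective_equator : Injective (equator n) := by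
  intro p p' h
  have hv := congrArg (fun v : 𝕊 (n + 1) ↦ (v : 𝔼 (n + 1 + 1))) h
  apply Subtype.ext
  ext i
  refine Fin.cases ?_ (fun j ↦ ?_) i
  · simpa using congrArg (fun v : 𝔼 (n + 1 + 1) ↦ v 0) hv
  · simpa using congrArg (fun v : 𝔼 (n + 1 + 1) ↦ v j.succ.succ) hv

/-- The image of the equatorial inclusion is the great sphere `{v₁ = 0}`. [folklore] -/
theorem range_equator : range (equator n) = {v : 𝕊 (n + 1) | (v : 𝔼 (n + 1 + 1)) 1 = 0} := by
  apply Subset.antisymm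
  · rintro _ ⟨p, rfl⟩
    exact coe_equator_apply_one n p
  · intro v hv
    have hv : (v : 𝔼 (n + 1 + 1)) (0 : Fin (n + 1)).succ = 0 := hv
    -- the preimage point `(v₀, v₂, …, vₙ₊₁)`
    set x : 𝔼 (n + 1) := WithLp.toLp 2 (Fin.cons ((v : 𝔼 (n + 1 + 1)) 0)
      fun j : Fin n ↦ (v : 𝔼 (n + 1 + 1)) j.succ.succ) with hx
    have hx0 : x 0 = (v : 𝔼 (n + 1 + 1)) 0 := by simp [hx]
    have hxs : ∀ j : Fin n, x j.succ = (v : 𝔼 (n + 1 + 1)) j.succ.succ := fun j ↦ by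
      simp [hx]
    have hxn : ‖x‖ = 1 := by
      have h1 : ‖(v : 𝔼 (n + 1 + 1))‖ ^ 2 = 1 := by rw [norm_eq_of_mem_sphere v, one_pow]
      rw [EuclideanSpace.real_norm_sq_eq, Fin.sum_univ_succ, Fin.sum_univ_succ, hv] at h1
      have h2 : ‖x‖ ^ 2 = 1 := by
        rw [EuclideanSpace.real_norm_sq_eq, Fin.sum_univ_succ, hx0]
        simp only [hxs]
        simpa using h1
      exact (pow_left_inj₀ (norm_nonneg _) zero_le_one two_ne_zero).1 (by rw [h2, one_pow])
    refine ⟨⟨x, mem_sphere_zero_iff_norm.2 hxn⟩, Subtype.ext ?_⟩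
    ext i
    refine Fin.cases ?_ (fun i' ↦ Fin.cases ?_ (fun j ↦ ?_) i') i
    · simp [hx0]
    · rw [hv]; exact coe_equator_apply_one n _
    · simp [hxs]


/-! ### The `z`-coordinate and the partial inverse of the surgery map -/

/-- The `z`-part `v₀ + i v₁ ∈ ℂ` of a vector of `ℝⁿ⁺²`. [folklore] -/
def zc (v : 𝔼 (n + 1 + 1)) : ℂ := ⟨v 0, v 1⟩

/-- Coordinate/unfolding lemma `zc_re`. [folklore] -/
@[simp] theorem zc_re (v : 𝔼 (n + 1 + 1)) : (zc n v).re = v 0 := rfl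

/-- Coordinate/unfolding lemma `zc_im`. [folklore] -/
@[simp] theorem zc_im (v : 𝔼 (n + 1 + 1)) : (zc n v).im = v 1 := rfl

/-- `zc` is smooth (linear). [folklore] -/
theorem contDiff_zc : ContDiff ℝ ∞ (zc n) := by
  have h : zc n = fun v ↦ ((v 0 : ℝ) : ℂ) + ((v 1 : ℝ) : ℂ) * Complex.I := by
    funext v; exact Complex.mk_eq_add_mul_I _ _
  rw [h]
  exact ((Complex.ofRealCLM.contDiff.comp (contDiff_piLp_apply (𝕜 := ℝ) (p := 2) (i := 0))).add
    ((Complex.ofRealCLM.contDiff.comp (contDiff_piLp_apply (𝕜 := ℝ) (p := 2) (i := 1))).mul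
      contDiff_const))

/-- `‖zc v‖² = v₀² + v₁²`. [folklore] -/
theorem norm_zc_sq (v : 𝔼 (n + 1 + 1)) : ‖zc n v‖ ^ 2 = v 0 ^ 2 + v 1 ^ 2 := by
  rw [Complex.sq_norm, Complex.normSq_apply, zc_re, zc_im]; ring

/-- The `z`-part of `Θ (u, p)` is `p₀ u`. [folklore] -/
theorem zc_coe_map (q : Circle × 𝕊 n) :
    zc n (map n q : 𝔼 (n + 1 + 1)) = (((q.2 : 𝔼 (n + 1)) 0 : ℝ) : ℂ) * (q.1 : ℂ) := by
  apply Complex.ext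
  · simp
  · simp

/-- `‖z-part of Θ (u, p)‖ = |p₀|`. [folklore] -/
theorem norm_zc_coe_map (q : Circle × 𝕊 n) :
    ‖zc n (map n q : 𝔼 (n + 1 + 1))‖ = |(q.2 : 𝔼 (n + 1)) 0| := by
  rw [zc_coe_map, norm_mul, Complex.norm_real, q.1.norm_coe, mul_one, Real.norm_eq_abs]

/-- The circle coordinate `z/‖z‖` of the partial inverse (set to `1` where `z = 0`).
[folklore] -/
def invC (v : 𝔼 (n + 1 + 1)) : ℂ := if zc n v = 0 then 1 else (‖zc n v‖⁻¹ : ℝ) • zc n v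

/-- Coordinate/unfolding lemma `invC_of_ne`. [folklore] -/
theorem invC_of_ne {v : 𝔼 (n + 1 + 1)} (hv : zc n v ≠ 0) :
    invC n v = (‖zc n v‖⁻¹ : ℝ) • zc n v := if_neg hv

/-- `‖invC v‖ = 1`. [folklore] -/
theorem norm_invC (v : 𝔼 (n + 1 + 1)) : ‖invC n v‖ = 1 := by
  unfold invC
  split_ifs with h
  · simp
  · rw [norm_smul, norm_inv, norm_norm, inv_mul_cancel₀ (norm_ne_zero_iff.2 h)]

/-- The circle coordinate of the partial inverse, as a point of `S¹`. [folklore] -/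
def invCircle (v : 𝔼 (n + 1 + 1)) : Circle :=
  ⟨invC n v, mem_sphere_zero_iff_norm.2 (norm_invC n v)⟩

/-- Coordinate/unfolding lemma `coe_invCircle`. [folklore] -/
@[simp] theorem coe_invCircle (v : 𝔼 (n + 1 + 1)) : (invCircle n v : ℂ) = invC n v := rfl

/-- The `Sⁿ`-coordinate `(‖z‖, v₂, …, vₙ₊₁)` of the partial inverse. [folklore] -/
def invVec (v : 𝔼 (n + 1 + 1)) : 𝔼 (n + 1) :=
  WithLp.toLp 2 (Fin.cons ‖zc n v‖ fun j : Fin n ↦ v j.succ.succ)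

/-- Coordinate/unfolding lemma `invVec_apply_zero`. [folklore] -/
@[simp] theorem invVec_apply_zero (v : 𝔼 (n + 1 + 1)) : invVec n v 0 = ‖zc n v‖ := by
  simp [invVec]

/-- Coordinate/unfolding lemma `invVec_apply_succ`. [folklore] -/
@[simp] theorem invVec_apply_succ (v : 𝔼 (n + 1 + 1)) (j : Fin n) :
    invVec n v j.succ = v j.succ.succ := by
  simp [invVec]

/-- `‖invVec v‖ = 1` for `v ∈ Sⁿ⁺¹`. [folklore] -/
theorem norm_invVec (v : 𝕊 (n + 1)) : ‖invVec n (v : 𝔼 (n + 1 + 1))‖ = 1 := by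
  have h1 : ‖(v : 𝔼 (n + 1 + 1))‖ ^ 2 = 1 := by rw [norm_eq_of_mem_sphere v, one_pow]
  rw [EuclideanSpace.real_norm_sq_eq, Fin.sum_univ_succ, Fin.sum_univ_succ] at h1
  have h2 : ‖invVec n (v : 𝔼 (n + 1 + 1))‖ ^ 2 = 1 := by
    rw [EuclideanSpace.real_norm_sq_eq, Fin.sum_univ_succ, invVec_apply_zero, norm_zc_sq]
    simp only [invVec_apply_succ]
    show (v : 𝔼 (n + 1 + 1)) 0 ^ 2 + (v : 𝔼 (n + 1 + 1)) (0 : Fin (n + 1)).succ ^ 2 +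
      ∑ x : Fin n, (v : 𝔼 (n + 1 + 1)) x.succ.succ ^ 2 = 1
    linarith [h1]
  exact (pow_left_inj₀ (norm_nonneg _) zero_le_one two_ne_zero).1 (by rw [h2, one_pow])

/-- **The partial inverse** `Θ⁻¹ : Sⁿ⁺¹ → S¹ × Sⁿ`, `v ↦ (z/‖z‖, (‖z‖, v₂, …, vₙ₊₁))` with
`z = v₀ + i v₁` (extended by `z/‖z‖ := 1` over the great sphere `{z = 0}`); it inverts `Θ` on
the open solid torus `{p₀ > 0}`. [folklore] -/
def inv (v : 𝕊 (n + 1)) : Circle × 𝕊 n :=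
  (invCircle n v, ⟨invVec n v, mem_sphere_zero_iff_norm.2 (norm_invVec n v)⟩)

/-- Coordinate/unfolding lemma `inv_fst`. [folklore] -/
@[simp] theorem inv_fst (v : 𝕊 (n + 1)) : (inv n v).1 = invCircle n v := rfl

/-- Coordinate/unfolding lemma `coe_inv_snd`. [folklore] -/
@[simp] theorem coe_inv_snd (v : 𝕊 (n + 1)) :
    ((inv n v).2 : 𝔼 (n + 1)) = invVec n (v : 𝔼 (n + 1 + 1)) := rfl

/-- **`Θ⁻¹ ∘ Θ = id` on the open solid torus `{p₀ > 0}`.** [folklore] -/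
theorem inv_map {q : Circle × 𝕊 n} (hq : 0 < (q.2 : 𝔼 (n + 1)) 0) : inv n (map n q) = q := by
  have hz : zc n (map n q : 𝔼 (n + 1 + 1)) = (((q.2 : 𝔼 (n + 1)) 0 : ℝ) : ℂ) * (q.1 : ℂ) :=
    zc_coe_map n q
  have hzn : ‖zc n (map n q : 𝔼 (n + 1 + 1))‖ = (q.2 : 𝔼 (n + 1)) 0 := by
    rw [norm_zc_coe_map, abs_of_pos hq]
  have hz0 : zc n (map n q : 𝔼 (n + 1 + 1)) ≠ 0 := by
    rw [← norm_ne_zero_iff, hzn]; exact hq.ne'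
  refine Prod.ext (Circle.ext ?_) (Subtype.ext ?_)
  · rw [inv_fst, coe_invCircle, invC_of_ne n hz0, hzn, hz, Complex.real_smul, ← mul_assoc,
      ← Complex.ofReal_mul, inv_mul_cancel₀ hq.ne', Complex.ofReal_one, one_mul]
  · rw [coe_inv_snd]
    ext i
    refine Fin.cases ?_ (fun j ↦ ?_) i
    · rw [invVec_apply_zero, hzn]
    · rw [invVec_apply_succ, coe_map, vec_apply_succ_succ]

/-- **`Θ ∘ Θ⁻¹ = id` off the great sphere `{z = 0}`.** [folklore] -/
theorem map_inv {v : 𝕊 (n + 1)} (hv : zc n (v : 𝔼 (n + 1 + 1)) ≠ 0) : map n (inv n v) = v := by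
  have hρ : ‖zc n (v : 𝔼 (n + 1 + 1))‖ ≠ 0 := norm_ne_zero_iff.2 hv
  apply Subtype.ext
  ext i
  refine Fin.cases ?_ (fun i' ↦ Fin.cases ?_ (fun j ↦ ?_) i') i
  · rw [coe_map, vec_apply_zero, coe_inv_snd, invVec_apply_zero, inv_fst, coe_invCircle,
      invC_of_ne n hv, Complex.smul_re, zc_re, smul_eq_mul, ← mul_assoc, mul_inv_cancel₀ hρ,
      one_mul]
  · rw [coe_map, vec_apply_succ_zero, coe_inv_snd, invVec_apply_zero, inv_fst, coe_invCircle,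
      invC_of_ne n hv, Complex.smul_im, zc_im, smul_eq_mul, ← mul_assoc, mul_inv_cancel₀ hρ,
      one_mul]
    rfl
  · rw [coe_map, vec_apply_succ_succ, coe_inv_snd, invVec_apply_succ]

/-- `Θ (u, p)` lies off the great sphere `{z = 0}` iff `p₀ ≠ 0`. [folklore] -/
theorem zc_coe_map_ne_zero_iff (q : Circle × 𝕊 n) :
    zc n (map n q : 𝔼 (n + 1 + 1)) ≠ 0 ↔ (q.2 : 𝔼 (n + 1)) 0 ≠ 0 := by
  rw [← norm_ne_zero_iff, norm_zc_coe_map, abs_ne_zero]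

/-- The `Sⁿ`-coordinate of `Θ⁻¹ v` has `p₀ = ‖z‖`. [folklore] -/
theorem coe_inv_snd_apply_zero (v : 𝕊 (n + 1)) :
    ((inv n v).2 : 𝔼 (n + 1)) 0 = ‖zc n (v : 𝔼 (n + 1 + 1))‖ := by
  rw [coe_inv_snd, invVec_apply_zero]

/-- **The surgery map is injective on the open solid torus `{p₀ > 0}`.** [folklore] -/
theorem injOn_map : InjOn (map n) {q : Circle × 𝕊 n | 0 < (q.2 : 𝔼 (n + 1)) 0} := by
  intro q hq q' hq' h
  rw [← inv_map n hq, ← inv_map n hq', h]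

/-- **The surgery map carries the open solid torus `{p₀ > 0}` onto the complement of the great
sphere `{z = 0}`.** [folklore] -/
theorem image_map_setOf_pos :
    map n '' {q : Circle × 𝕊 n | 0 < (q.2 : 𝔼 (n + 1)) 0} =
      {v : 𝕊 (n + 1) | zc n (v : 𝔼 (n + 1 + 1)) ≠ 0} := by
  apply Subset.antisymm
  · rintro _ ⟨q, hq, rfl⟩
    exact (zc_coe_map_ne_zero_iff n q).2 (ne_of_gt hq)
  · intro v hv
    refine ⟨inv n v, ?_, map_inv n hv⟩
    show 0 < ((inv n v).2 : 𝔼 (n + 1)) 0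
    rw [coe_inv_snd_apply_zero]
    exact norm_pos_iff.2 hv

/-- The complement of the great sphere `{z = 0}` is open in `Sⁿ⁺¹`. [folklore] -/
theorem isOpen_setOf_zc_ne :
    IsOpen {v : 𝕊 (n + 1) | zc n (v : 𝔼 (n + 1 + 1)) ≠ 0} :=
  isOpen_ne_fun ((contDiff_zc n).continuous.comp continuous_subtype_val) continuous_const

/-- **The partial inverse is smooth off the great sphere `{z = 0}`.** [folklore] -/
theorem contMDiffOn_inv :
    ContMDiffOn (𝓡 (n + 1)) ((𝓡 1).prod (𝓡 n)) ∞ (inv n)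
      {v : 𝕊 (n + 1) | zc n (v : 𝔼 (n + 1 + 1)) ≠ 0} := by
  have hO := isOpen_setOf_zc_ne n
  have hzc : ContMDiff (𝓡 (n + 1)) 𝓘(ℝ, ℂ) ∞ (fun v : 𝕊 (n + 1) ↦ zc n (v : 𝔼 (n + 1 + 1))) :=
    (contDiff_zc n).contMDiff.comp contMDiff_coe_sphere
  have hnorm : ContMDiffOn (𝓡 (n + 1)) 𝓘(ℝ, ℝ) ∞ (fun v : 𝕊 (n + 1) ↦ ‖zc n (v : 𝔼 (n + 1 + 1))‖)
      {v : 𝕊 (n + 1) | zc n (v : 𝔼 (n + 1 + 1)) ≠ 0} := fun v hv ↦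
    ((contDiffAt_norm ℝ hv).contMDiffAt.comp v (hzc v)).contMDiffWithinAt
  -- the circle coordinate
  have hu : ∀ w : ℂ, w ≠ 0 → ContDiffAt ℝ ∞ (fun w : ℂ ↦ (‖w‖⁻¹ : ℝ) • w) w := fun w hw ↦
    ((contDiffAt_norm ℝ hw).inv (norm_ne_zero_iff.2 hw)).smul contDiffAt_id
  have h1 : ContMDiffOn (𝓡 (n + 1)) 𝓘(ℝ, ℂ) ∞ (fun v : 𝕊 (n + 1) ↦ invC n (v : 𝔼 (n + 1 + 1)))
      {v : 𝕊 (n + 1) | zc n (v : 𝔼 (n + 1 + 1)) ≠ 0} := fun v hv ↦ by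
    have hcd : ContDiffAt ℝ ∞ (invC n) (v : 𝔼 (n + 1 + 1)) := by
      have hev : invC n =ᶠ[𝓝 (v : 𝔼 (n + 1 + 1))] fun w ↦ (‖zc n w‖⁻¹ : ℝ) • zc n w :=
        Filter.eventually_of_mem
          ((isOpen_ne_fun (contDiff_zc n).continuous continuous_const).mem_nhds hv)
          fun w hw ↦ invC_of_ne n hw
      refine ContDiffAt.congr_of_eventuallyEq ?_ hev
      exact (hu _ hv).comp _ (contDiff_zc n).contDiffAt
    exact (hcd.contMDiffAt.comp v contMDiff_coe_sphere.contMDiffAt).contMDiffWithinAt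
  have h1' : ContMDiffOn (𝓡 (n + 1)) (𝓡 1) ∞ (fun v : 𝕊 (n + 1) ↦ invCircle n (v : 𝔼 (n + 1 + 1)))
      {v : 𝕊 (n + 1) | zc n (v : 𝔼 (n + 1 + 1)) ≠ 0} :=
    contMDiffOn_codRestrict_sphere hO h1 fun v ↦ mem_sphere_zero_iff_norm.2 (norm_invC n _)
  -- the `Sⁿ`-coordinate
  have hG : ContDiff ℝ ∞ (fun p : ℝ × 𝔼 (n + 1 + 1) ↦
      (WithLp.toLp 2 (Fin.cons p.1 fun j : Fin n ↦ p.2 j.succ.succ) : 𝔼 (n + 1))) := by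
    rw [contDiff_euclidean]
    intro i
    refine Fin.cases ?_ (fun j ↦ ?_) i
    · simp only [Fin.cons_zero]
      exact contDiff_fst
    · simp only [Fin.cons_succ]
      exact (contDiff_piLp_apply (𝕜 := ℝ) (p := 2) (i := j.succ.succ)).comp contDiff_snd
  have h2 : ContMDiffOn (𝓡 (n + 1)) 𝓘(ℝ, 𝔼 (n + 1)) ∞
      (fun v : 𝕊 (n + 1) ↦ invVec n (v : 𝔼 (n + 1 + 1)))
      {v : 𝕊 (n + 1) | zc n (v : 𝔼 (n + 1 + 1)) ≠ 0} :=
    hG.contMDiff.comp_contMDiffOn (hnorm.prodMk_space contMDiff_coe_sphere.contMDiffOn)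
  have h2' : ContMDiffOn (𝓡 (n + 1)) (𝓡 n) ∞
      (fun v : 𝕊 (n + 1) ↦ (⟨invVec n (v : 𝔼 (n + 1 + 1)),
        mem_sphere_zero_iff_norm.2 (norm_invVec n v)⟩ : 𝕊 n))
      {v : 𝕊 (n + 1) | zc n (v : 𝔼 (n + 1 + 1)) ≠ 0} := by
    have key : ∀ w : 𝔼 (n + 1 + 1), ‖w‖ = 1 → invVec n w ∈ sphere (0 : 𝔼 (n + 1)) 1 := fun w hw ↦
      mem_sphere_zero_iff_norm.2 (norm_invVec n ⟨w, mem_sphere_zero_iff_norm.2 hw⟩)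
    -- restrict along the (globally unit, by a radial correction) vector-valued map
    have h3 : ContMDiffOn (𝓡 (n + 1)) (𝓡 n) ∞
        (Set.codRestrict (fun v : 𝕊 (n + 1) ↦ invVec n (v : 𝔼 (n + 1 + 1))) (sphere 0 1)
          fun v ↦ key v (norm_eq_of_mem_sphere v))
        {v : 𝕊 (n + 1) | zc n (v : 𝔼 (n + 1 + 1)) ≠ 0} :=
      contMDiffOn_codRestrict_sphere hO h2 _
    exact h3
  exact h1'.prodMk h2'


/-! ### Differentials: the equatorial inclusion and the surgery map are immersions -/

/-- The equatorial inclusion read in `ℝⁿ⁺¹`, as a linear map `x ↦ (x₀, 0, x₁, …, xₙ)`.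
[folklore] -/
def eqL : 𝔼 (n + 1) →ₗ[ℝ] 𝔼 (n + 1 + 1) where
  toFun x := vec n (1, x)
  map_add' x y := by
    ext i
    refine Fin.cases ?_ (fun i' ↦ Fin.cases ?_ (fun j ↦ ?_) i') i
    · simp
    · simp
    · simp
  map_smul' c x := by
    ext i
    refine Fin.cases ?_ (fun i' ↦ Fin.cases ?_ (fun j ↦ ?_) i') i
    · simp
    · simp
    · simp

/-- The equatorial inclusion read in `ℝⁿ⁺¹`, as a continuous linear map. [folklore] -/
def eqCLM : 𝔼 (n + 1) →L[ℝ] 𝔼 (n + 1 + 1) := LinearMap.toContinuousLinearMap (eqL n)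

/-- Coordinate/unfolding lemma `eqCLM_apply`. [folklore] -/
theorem eqCLM_apply (x : 𝔼 (n + 1)) : eqCLM n x = vec n (1, x) := rfl

/-- `ι_E` is the restriction of `eqCLM` (definitional). [folklore] -/
theorem coe_equator_eq (p : 𝕊 n) : (equator n p : 𝔼 (n + 1 + 1)) = eqCLM n (p : 𝔼 (n + 1)) :=
  rfl

/-- `eqCLM` is injective. [folklore] -/
theorem injective_eqCLM : Injective (eqCLM n) := by
  intro x y h
  rw [eqCLM_apply, eqCLM_apply] at h
  ext i
  refine Fin.cases ?_ (fun j ↦ ?_) i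
  · simpa using congrArg (fun v : 𝔼 (n + 1 + 1) ↦ v 0) h
  · simpa using congrArg (fun v : 𝔼 (n + 1 + 1) ↦ v j.succ.succ) h

/-- **The equatorial inclusion is an immersion**: its differential is injective at every point
(it is the restriction of the injective linear map `eqCLM`, and the inclusion `Sⁿ⁺¹ ⊆ ℝⁿ⁺²` has
injective differential). [folklore] -/
theorem mfderiv_equator_injective (p : 𝕊 n) :
    Injective (mfderiv (𝓡 n) (𝓡 (n + 1)) (equator n) p) := by
  have hval : MDifferentiableAt (𝓡 (n + 1)) 𝓘(ℝ, 𝔼 (n + 1 + 1))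
      (Subtype.val : 𝕊 (n + 1) → 𝔼 (n + 1 + 1)) (equator n p) :=
    (contMDiff_coe_sphere (m := ∞)).contMDiffAt.mdifferentiableAt (by simp)
  have heq : MDifferentiableAt (𝓡 n) (𝓡 (n + 1)) (equator n) p :=
    (contMDiff_equator n).contMDiffAt.mdifferentiableAt (by simp)
  have hchain : mfderiv (𝓡 n) 𝓘(ℝ, 𝔼 (n + 1 + 1)) (fun p : 𝕊 n ↦ (equator n p : 𝔼 (n + 1 + 1))) p =
      (mfderiv (𝓡 (n + 1)) 𝓘(ℝ, 𝔼 (n + 1 + 1)) (Subtype.val : 𝕊 (n + 1) → 𝔼 (n + 1 + 1))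
        (equator n p)).comp (mfderiv (𝓡 n) (𝓡 (n + 1)) (equator n) p) :=
    mfderiv_comp p hval heq
  have hval' : MDifferentiableAt (𝓡 n) 𝓘(ℝ, 𝔼 (n + 1))
      (Subtype.val : 𝕊 n → 𝔼 (n + 1)) p :=
    (contMDiff_coe_sphere (m := ∞)).contMDiffAt.mdifferentiableAt (by simp)
  have hL : MDifferentiableAt 𝓘(ℝ, 𝔼 (n + 1)) 𝓘(ℝ, 𝔼 (n + 1 + 1)) (eqCLM n) (p : 𝔼 (n + 1)) :=
    (eqCLM n).mdifferentiableAt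
  have hchain' : mfderiv (𝓡 n) 𝓘(ℝ, 𝔼 (n + 1 + 1)) (fun p : 𝕊 n ↦ (equator n p : 𝔼 (n + 1 + 1))) p =
      (mfderiv 𝓘(ℝ, 𝔼 (n + 1)) 𝓘(ℝ, 𝔼 (n + 1 + 1)) (eqCLM n) (p : 𝔼 (n + 1))).comp
        (mfderiv (𝓡 n) 𝓘(ℝ, 𝔼 (n + 1)) (Subtype.val : 𝕊 n → 𝔼 (n + 1)) p) :=
    mfderiv_comp p hL hval'
  rw [ContinuousLinearMap.mfderiv_eq] at hchain'
  have hinj : Injective (mfderiv (𝓡 n) 𝓘(ℝ, 𝔼 (n + 1 + 1))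
      (fun p : 𝕊 n ↦ (equator n p : 𝔼 (n + 1 + 1))) p) := by
    rw [hchain']
    have key : Injective (⇑(eqCLM n) ∘
        ⇑(mfderiv (𝓡 n) 𝓘(ℝ, 𝔼 (n + 1)) (Subtype.val : 𝕊 n → 𝔼 (n + 1)) p)) :=
      (injective_eqCLM n).comp (mfderiv_coe_sphere_injective p)
    exact key
  rw [hchain] at hinj
  have key : Injective (⇑(mfderiv (𝓡 (n + 1)) 𝓘(ℝ, 𝔼 (n + 1 + 1))
      (Subtype.val : 𝕊 (n + 1) → 𝔼 (n + 1 + 1)) (equator n p)) ∘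
        ⇑(mfderiv (𝓡 n) (𝓡 (n + 1)) (equator n) p)) := hinj
  exact key.of_comp

/-- The open solid torus `{p₀ > 0}` is open. [folklore] -/
theorem isOpen_setOf_pos : IsOpen {q : Circle × 𝕊 n | 0 < (q.2 : 𝔼 (n + 1)) 0} :=
  isOpen_lt continuous_const
    ((EuclideanSpace.proj (0 : Fin (n + 1))).continuous.comp
      (continuous_subtype_val.comp continuous_snd))

/-- **The surgery map is an immersion (indeed a local diffeomorphism) on the open solid torus
`{p₀ > 0}`**: its differential is injective there, `Θ⁻¹ ∘ Θ = id` near the point. [folklore] -/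
theorem mfderiv_map_injective {q : Circle × 𝕊 n} (hq : 0 < (q.2 : 𝔼 (n + 1)) 0) :
    Injective (mfderiv ((𝓡 1).prod (𝓡 n)) (𝓡 (n + 1)) (map n) q) := by
  have hz : zc n (map n q : 𝔼 (n + 1 + 1)) ≠ 0 := (zc_coe_map_ne_zero_iff n q).2 hq.ne'
  have hinv : MDifferentiableAt (𝓡 (n + 1)) ((𝓡 1).prod (𝓡 n)) (inv n) (map n q) :=
    ((contMDiffOn_inv n).contMDiffAt ((isOpen_setOf_zc_ne n).mem_nhds hz)).mdifferentiableAt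
      (by simp)
  have hmap : MDifferentiableAt ((𝓡 1).prod (𝓡 n)) (𝓡 (n + 1)) (map n) q :=
    (contMDiff_map n).contMDiffAt.mdifferentiableAt (by simp)
  have hchain : mfderiv ((𝓡 1).prod (𝓡 n)) ((𝓡 1).prod (𝓡 n)) (inv n ∘ map n) q =
      (mfderiv (𝓡 (n + 1)) ((𝓡 1).prod (𝓡 n)) (inv n) (map n q)).comp
        (mfderiv ((𝓡 1).prod (𝓡 n)) (𝓡 (n + 1)) (map n) q) :=
    mfderiv_comp q hinv hmap
  have hev : (inv n ∘ map n) =ᶠ[𝓝 q] id :=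
    Filter.eventually_of_mem ((isOpen_setOf_pos n).mem_nhds hq) fun q' hq' ↦ inv_map n hq'
  have hid : mfderiv ((𝓡 1).prod (𝓡 n)) ((𝓡 1).prod (𝓡 n)) (inv n ∘ map n) q =
      ContinuousLinearMap.id ℝ (TangentSpace ((𝓡 1).prod (𝓡 n)) q) := by
    rw [hev.mfderiv_eq, mfderiv_id]
  have hinj : Injective (mfderiv ((𝓡 1).prod (𝓡 n)) ((𝓡 1).prod (𝓡 n)) (inv n ∘ map n) q) := by
    rw [hid]; exact injective_id
  rw [hchain] at hinj
  have key : Injective (⇑(mfderiv (𝓡 (n + 1)) ((𝓡 1).prod (𝓡 n)) (inv n) (map n q)) ∘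
      ⇑(mfderiv ((𝓡 1).prod (𝓡 n)) (𝓡 (n + 1)) (map n) q)) := hinj
  exact key.of_comp

/-! ### Where the surgery map fails to be injective -/

/-- **Collisions with the standard sphere.** If `Θ (u, p) = ι_E p'` with `p₀ > 0`, then either
`(u, p) = (1, p')`, or `u = -1` and `p'₀ = -p₀ < 0` (the antipodal fibre over the northern
hemisphere is folded onto the lower half of the equatorial great sphere). [folklore] -/
theorem map_eq_equator {u : Circle} {p p' : 𝕊 n} (hp : 0 < (p : 𝔼 (n + 1)) 0)
    (h : map n (u, p) = equator n p') :
    (u = 1 ∧ p' = p) ∨ (u = -1 ∧ (p' : 𝔼 (n + 1)) 0 = -(p : 𝔼 (n + 1)) 0) := by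
  have hv := congrArg (fun v : 𝕊 (n + 1) ↦ (v : 𝔼 (n + 1 + 1))) h
  have h0 := congrArg (fun v : 𝔼 (n + 1 + 1) ↦ v 0) hv
  have h1 := congrArg (fun v : 𝔼 (n + 1 + 1) ↦ v 1) hv
  simp only [coe_map, vec_apply_zero, vec_apply_one, coe_equator_apply_zero,
    coe_equator_apply_one] at h0 h1
  have him : (u : ℂ).im = 0 := by
    rcases mul_eq_zero.1 h1 with h | h
    · exact absurd h hp.ne'
    · exact h
  have hre2 : (u : ℂ).re * (u : ℂ).re = 1 := by
    have h := Complex.normSq_eq_norm_sq (u : ℂ)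
    rw [u.norm_coe, Complex.normSq_apply, him] at h
    nlinarith [h]
  rcases mul_self_eq_one_iff.1 hre2 with hre | hre
  · left
    have hu : u = 1 := Circle.ext (Complex.ext (by simpa using hre) (by simpa using him))
    subst hu
    exact ⟨rfl, (injective_equator n h).symm⟩
  · right
    refine ⟨Circle.ext (Complex.ext (by simpa using hre) (by simpa using him)), ?_⟩
    rw [← h0, hre]; ring

end Surgery

end BudneyGabai2019_thm_3_13

end Literature.Topology.FourManifolds

end
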